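import Mathlib.Analysis.Calculus.UniformLimitsDeriv
import Mathlib.Analysis.SpecificLimits.Basic
import Literature.Analysis.FluidPDE.SelfSimilar
import Summits.NavierStokesRegularity.NavierStokesRegularity.Theorems.AdaptedFrequencyFrequencyRigidityKernelPairingLemmas

/-!
# Crux `FrequencyRigidity` (stmt-NavierStokesRegularity-2955), line `two-ended-pinning`:
  STUB `stub_kernelPairing` — the transport-free first variation against an adapted kernel

Proves the registered stub `stub_kernelPairing` of the line's skeleton (PURE KERNEL CALCULUS, no
Navier–Stokes): for a jointly smooth divergence-free drift `v` on `ℝ³ × (−∞, 0)` with the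
time-Type-I bound `‖v(t)‖∞ ≤ C/√(−t)`, an adapted backward kernel `K` of `∂ₜ + v·∇ − νΔ` on
`(−∞, 0)` with pole `(0, 0)` (`IsAdaptedBackwardKernel`: jointly `C²`, `K > 0`, adjoint equation
`∂ₜK + DK·v + νΔK = 0`, unit mass) that is two-sided Gaussian-comparable
(`IsGaussianComparable`), and a jointly smooth scalar `φ` with `φ, Dφ, Δφ, ∂ₜφ` bounded on every
compact `[a, b] ⊂ (−∞, 0)` uniformly in `x`:
`d/dt ∫ φ(t) K(t) = ∫ (∂ₜφ + Dφ·v − νΔφ)(t) K(t)` at every `t < 0` — transport drops out exactly.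

Proof: the compactly supported identity of the helper file
(`kernelPairing_hasDerivAt_of_support_subset`, applied to the cut-off fields `φ χ_{n+1}`), the
Leibniz rules `D(φχ) = χDφ + φDχ`, `Δ(φχ) = χΔφ + φΔχ + 2 Σᵢ ∂ᵢφ ∂ᵢχ`, and the limit `n → ∞`
through Mathlib's `hasDerivAt_of_tendstoUniformlyOn` on a window `a < t < b < 0`: the cut-off
pairings converge pointwise (dominated convergence, `|φ| K ≤ B K`) and their derivatives converge
UNIFORMLY on `(a, b)`, the error being at most `M_A ∫ (1 − χ_{n+1}) g + M_R/(n + 1)` with the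
single Gaussian envelope `K(s, ·) ≤ g` on `[a, b]` (upper Aronson bound only) and the cut-off
bounds `‖Dχ_R‖ ≤ C₁/R`, `|Δχ_R| ≤ C₂/R²`.

References: A. Friedman, *Partial Differential Equations of Parabolic Type* (1964), Ch. 1 §8
[Friedman1964]; P. Constantin, G. Iyer, Comm. Pure Appl. Math. 61 (2008), §2
[ConstantinIyer2007]; D. G. Aronson, Bull. AMS 73 (1967), Thm 1 [Aronson1967].
-/

noncomputable section

namespace Summit.NavierStokesRegularity.NavierStokesRegularity.Theorems.FrequencyRigidity.TwoEndedPinning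

open Literature.Analysis.FluidPDE MeasureTheory Set Filter Topology Function
open scoped RealInnerProductSpace Laplacian ContDiff

/-! ### Two pointwise inequalities -/

/-- Pointwise bound for the full-space integrand `∂ₜφ + Dφ·v − νΔφ`:
`|d + L w − ν l| ≤ B + B V + |ν| B` when `|d|, ‖L‖, |l| ≤ B` and `‖w‖ ≤ V`. [folklore] -/
private theorem kernelPairing_abs_integrand_le {F : Type*} [NormedAddCommGroup F]
    [NormedSpace ℝ F] {d l ν B V : ℝ} {L : F →L[ℝ] ℝ} {w : F} (hd : |d| ≤ B) (hL : ‖L‖ ≤ B)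
    (hw : ‖w‖ ≤ V) (hl : |l| ≤ B) (hB : 0 ≤ B) :
    |d + L w - ν * l| ≤ B + B * V + |ν| * B := by
  have hLw : |L w| ≤ B * V := by
    rw [← Real.norm_eq_abs]
    exact (L.le_opNorm w).trans (mul_le_mul hL hw (norm_nonneg _) hB)
  have hνl : |ν * l| ≤ |ν| * B := by
    rw [abs_mul]
    exact mul_le_mul_of_nonneg_left hl (abs_nonneg ν)
  calc |d + L w - ν * l| ≤ |d + L w| + |ν * l| := abs_sub _ _
    _ ≤ |d| + |L w| + |ν * l| := by gcongr; exact abs_add_le _ _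
    _ ≤ B + B * V + |ν| * B := by gcongr

/-- Pointwise bound for the cut-off remainder `φ Dχ·v − ν (φ Δχ + 2 Σᵢ ∂ᵢφ ∂ᵢχ)` at scale
`R ≥ 1`: it is `O(1/R)`, with the constant `B C₁ V + |ν| (B C₂ + 2 B C₁)`. [folklore] -/
private theorem kernelPairing_abs_remainder_le {F : Type*} [NormedAddCommGroup F]
    [NormedSpace ℝ F] {f l σ ν B V C₁ C₂ R m : ℝ} {G : F →L[ℝ] ℝ} {w : F} (hf : |f| ≤ B)
    (hG : ‖G‖ ≤ C₁ / R) (hw : ‖w‖ ≤ V) (hl : |l| ≤ C₂ / R ^ 2) (hσ : |σ| ≤ m * ‖G‖)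
    (hm : m ≤ B) (hB : 0 ≤ B) (hC₁ : 0 ≤ C₁) (hC₂ : 0 ≤ C₂) (hR : 1 ≤ R) :
    |f * G w - ν * (f * l + 2 * σ)| ≤ (B * C₁ * V + |ν| * (B * C₂ + 2 * (B * C₁))) / R := by
  have hR0 : 0 < R := one_pos.trans_le hR
  have h1 : |f * G w| ≤ B * C₁ * V / R := by
    rw [abs_mul]
    have hGw : |G w| ≤ C₁ / R * V := by
      rw [← Real.norm_eq_abs]
      exact (G.le_opNorm w).trans (mul_le_mul hG hw (norm_nonneg _) (div_nonneg hC₁ hR0.le))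
    calc |f| * |G w| ≤ B * (C₁ / R * V) := mul_le_mul hf hGw (abs_nonneg _) hB
      _ = B * C₁ * V / R := by ring
  have h2 : |f * l| ≤ B * C₂ / R := by
    rw [abs_mul]
    have hl' : |l| ≤ C₂ / R :=
      hl.trans (div_le_div_of_nonneg_left hC₂ hR0 (by nlinarith))
    calc |f| * |l| ≤ B * (C₂ / R) := mul_le_mul hf hl' (abs_nonneg _) hB
      _ = B * C₂ / R := by ring
  have h3 : |σ| ≤ B * C₁ / R := by
    calc |σ| ≤ m * ‖G‖ := hσ
      _ ≤ B * (C₁ / R) := mul_le_mul hm hG (norm_nonneg _) hB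
      _ = B * C₁ / R := by ring
  calc |f * G w - ν * (f * l + 2 * σ)| ≤ |f * G w| + |ν * (f * l + 2 * σ)| := abs_sub _ _
    _ = |f * G w| + |ν| * |f * l + 2 * σ| := by rw [abs_mul ν]
    _ ≤ |f * G w| + |ν| * (|f * l| + 2 * |σ|) := by
        gcongr
        calc |f * l + 2 * σ| ≤ |f * l| + |2 * σ| := abs_add_le _ _
          _ = |f * l| + 2 * |σ| := by rw [abs_mul 2, abs_two]
    _ ≤ B * C₁ * V / R + |ν| * (B * C₂ / R + 2 * (B * C₁ / R)) := by gcongr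
    _ = (B * C₁ * V + |ν| * (B * C₂ + 2 * (B * C₁))) / R := by ring

/-! ### The stub -/

/-- **Stub `stub_kernelPairing` — the transport-free first variation against an adapted kernel
(PURE KERNEL CALCULUS).** For a jointly smooth, divergence-free drift `v` on `ℝ³ × (−∞, 0)` with
the time-Type-I bound, an adapted backward kernel `K` of `∂ₜ + v·∇ − νΔ` on `(−∞, 0)` with pole
`(0, 0)` (jointly `C²`, positive, adjoint equation `∂ₜK + DK·v + νΔK = 0`, unit mass) that is
two-sided Gaussian-comparable, and a jointly smooth scalar `φ` with `φ, Dφ, Δφ, ∂ₜφ` bounded on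
every compact `[a, b] ⊂ (−∞, 0)` uniformly in `x`: `t ↦ ∫ φ(t) K(t)` has derivative
`∫ (∂ₜφ + Dφ·v − νΔφ)(t) K(t)` at every `t < 0` — transport drops out exactly (Friedman 1964,
Ch. 1 §8: `K = Γ*` solves the adjoint equation; Constantin–Iyer 2008, §2). Proof: cut off with
`χ_{n+1}` (`kernelPairing_hasDerivAt_of_support_subset` of the helper file: differentiation
under the integral sign, adjoint equation, transport integration by parts with `div v = 0`,
Green), expand `D(φχ)`, `Δ(φχ)` by the Leibniz rules, and let `n → ∞` on a window
`a < t < b < 0` with `hasDerivAt_of_tendstoUniformlyOn`: pointwise convergence of the pairings by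
dominated convergence and UNIFORM convergence of the derivatives, the error being
`≤ M_A ∫ (1 − χ_{n+1}) g + M_R/(n+1)` with one Gaussian envelope `K ≤ g` on `[a, b]` (upper
Aronson bound), `‖Dχ_R‖ ≤ C₁/R`, `|Δχ_R| ≤ C₂/R²` and `∫ K = 1`.
[cite: Friedman1964, Ch. 1 §8 (adjoint operator); ConstantinIyer2007, §2] -/
theorem stub_kernelPairing :
  ∀ (ν C : ℝ) (v : ℝ → EuclideanSpace ℝ (Fin 3) → EuclideanSpace ℝ (Fin 3))
    (K φ : ℝ → EuclideanSpace ℝ (Fin 3) → ℝ),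
    Literature.Analysis.FluidPDE.IsSmoothSpaceTimeOn (Set.Iio 0) v →
    (∀ t ∈ Set.Iio (0 : ℝ), Literature.Analysis.FluidPDE.VectorCalculus.IsDivFree (v t)) →
    Literature.Analysis.FluidPDE.HasTypeITimeDecay C v →
    Literature.Analysis.FluidPDE.IsAdaptedBackwardKernel ν v (Set.Iio 0) 0 0 K →
    Literature.Analysis.FluidPDE.IsGaussianComparable K (Set.Iio 0) 0 0 →
    Literature.Analysis.FluidPDE.IsSmoothSpaceTimeOn (Set.Iio 0) φ →
    (∀ a b : ℝ, a < b → b < 0 → ∃ B : ℝ, ∀ t ∈ Set.Icc a b, ∀ x : EuclideanSpace ℝ (Fin 3),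
        |φ t x| ≤ B ∧ ‖fderiv ℝ (φ t) x‖ ≤ B ∧ |Laplacian.laplacian (φ t) x| ≤ B ∧
          |deriv (fun s => φ s x) t| ≤ B) →
    ∀ t : ℝ, t < 0 →
      HasDerivAt (fun s => ∫ x, φ s x * K s x)
        (∫ x, (deriv (fun s => φ s x) t + fderiv ℝ (φ t) x (v t x)
                - ν * Laplacian.laplacian (φ t) x) * K t x) t := by
  intro ν C v K φ hv hdiv hTI hK hG hφ hbounds t ht
  /- 1. The time window `a < t < b < 0` and the constants. -/
  obtain ⟨a, ha⟩ : ∃ a : ℝ, a = t - 1 := ⟨_, rfl⟩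
  obtain ⟨b, hb⟩ : ∃ b : ℝ, b = t / 2 := ⟨_, rfl⟩
  have hat : a < t := by rw [ha]; linarith
  have htb : t < b := by rw [hb]; linarith
  have hb0 : b < 0 := by rw [hb]; linarith
  have hab : a < b := hat.trans htb
  have htI : t ∈ Ioo a b := ⟨hat, htb⟩
  have hIcc : Icc a b ⊆ Iio (0 : ℝ) := fun s hs => lt_of_le_of_lt hs.2 hb0
  have hIoo : Ioo a b ⊆ Icc a b := Ioo_subset_Icc_self
  obtain ⟨B, hB⟩ := hbounds a b hab hb0
  have hB0 : 0 ≤ B := (abs_nonneg _).trans (hB t ⟨hat.le, htb.le⟩ 0).1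
  -- the drift bound on the window
  obtain ⟨V, hV⟩ : ∃ V : ℝ, V = |C| / Real.sqrt (-b) := ⟨_, rfl⟩
  have hV0 : 0 ≤ V := by rw [hV]; positivity
  have hvV : ∀ s ∈ Icc a b, ∀ x, ‖v s x‖ ≤ V := by
    intro s hs x
    have hs0 : s < 0 := hIcc hs
    refine (hTI s hs0 x).trans ?_
    have h1 : Real.sqrt (-b) ≤ Real.sqrt (-s) := Real.sqrt_le_sqrt (by linarith [hs.2])
    have h2 : 0 < Real.sqrt (-b) := Real.sqrt_pos.2 (by linarith)
    rw [hV]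
    calc C / Real.sqrt (-s) ≤ |C| / Real.sqrt (-s) := by gcongr; exact le_abs_self C
      _ ≤ |C| / Real.sqrt (-b) := div_le_div_of_nonneg_left (abs_nonneg C) h2 h1
  -- one Gaussian envelope on the window (upper bound only)
  obtain ⟨g, hgi, hg0, hKg⟩ := kernelPairing_gaussian_envelope hG hab.le hb0 hIcc
  -- the cut-off bounds
  obtain ⟨C₁, hC₁0, hC₁⟩ := exists_norm_fderiv_cutoff_le (E := EuclideanSpace ℝ (Fin 3))
  obtain ⟨C₂, hC₂0, hC₂⟩ := exists_abs_laplacian_cutoff_le (E := EuclideanSpace ℝ (Fin 3))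
  set bs := stdOrthonormalBasis ℝ (EuclideanSpace ℝ (Fin 3)) with hbs
  -- slices of the data
  have hφs : ∀ s : ℝ, s < 0 → ContDiff ℝ ∞ (φ s) := fun s hs => hφ.contDiff_slice hs
  have hφ1 : ∀ s : ℝ, s < 0 → ContDiff ℝ 1 (φ s) := fun s hs => contDiff_infty.1 (hφs s hs) 1
  have hφ2 : ∀ s : ℝ, s < 0 → ContDiff ℝ 2 (φ s) := fun s hs => contDiff_infty.1 (hφs s hs) 2
  have hvc : ∀ s : ℝ, s < 0 → Continuous (v s) := fun s hs => (hv.contDiff_slice hs).continuous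
  have hKc : ∀ s : ℝ, s < 0 → Continuous (K s) := fun s hs => (hK.contDiff_slice hs).continuous
  have hK0 : ∀ s : ℝ, s < 0 → ∀ x, 0 ≤ K s x := fun s hs x => (hK.pos s hs x).le
  have hdc : ∀ s : ℝ, s < 0 → Continuous fun x => deriv (fun r => φ r x) s := fun s hs =>
    ((hφ.isSmoothSpaceTimeOn_deriv isOpen_Iio).contDiff_slice hs).continuous
  have hχc : ∀ R : ℝ, Continuous (cutoff (E := EuclideanSpace ℝ (Fin 3)) R) := fun R =>
    (contDiff_cutoff (n := 0) R).continuous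
  have hχ1 : ∀ R : ℝ, ContDiff ℝ 1 (cutoff (E := EuclideanSpace ℝ (Fin 3)) R) := fun R =>
    contDiff_cutoff R
  have hχ2 : ∀ R : ℝ, ContDiff ℝ 2 (cutoff (E := EuclideanSpace ℝ (Fin 3)) R) := fun R =>
    contDiff_cutoff R
  /- 2. The full-space integrand `A`, the cut-off remainder `Rem`, the derivative sequence. -/
  obtain ⟨A, hA⟩ : ∃ A : ℝ → EuclideanSpace ℝ (Fin 3) → ℝ, A = fun s x =>
      deriv (fun r => φ r x) s + fderiv ℝ (φ s) x (v s x) - ν * (Δ (φ s)) x := ⟨_, rfl⟩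
  obtain ⟨Rem, hRem⟩ : ∃ Rem : ℕ → ℝ → EuclideanSpace ℝ (Fin 3) → ℝ, Rem = fun (n : ℕ) s x =>
      φ s x * fderiv ℝ (cutoff ((n : ℝ) + 1)) x (v s x)
        - ν * (φ s x * (Δ (cutoff (E := EuclideanSpace ℝ (Fin 3)) ((n : ℝ) + 1))) x
          + 2 * ∑ i, fderiv ℝ (φ s) x (bs i) * fderiv ℝ (cutoff ((n : ℝ) + 1)) x (bs i)) :=
    ⟨_, rfl⟩
  obtain ⟨G, hGdef⟩ : ∃ G : ℝ → ℝ, G = fun s => ∫ x, A s x * K s x := ⟨_, rfl⟩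
  obtain ⟨gseq, hgseq⟩ : ∃ gseq : ℕ → ℝ → ℝ, gseq = fun (n : ℕ) s =>
      ∫ x, (cutoff ((n : ℝ) + 1) x * A s x + Rem n s x) * K s x := ⟨_, rfl⟩
  obtain ⟨e, he⟩ : ∃ e : ℕ → ℝ, e = fun n : ℕ => ∫ x, (1 - cutoff ((n : ℝ) + 1) x) * g x :=
    ⟨_, rfl⟩
  -- continuity of the integrands
  have hAc : ∀ s : ℝ, s < 0 → Continuous fun x => A s x := by
    intro s hs
    rw [hA]
    have h1 := hdc s hs
    have h2 : Continuous (fderiv ℝ (φ s)) := (hφ1 s hs).continuous_fderiv one_ne_zero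
    have h3 : Continuous (Δ (φ s)) := continuous_laplacian (hφ2 s hs)
    have h4 := hvc s hs
    exact (h1.add (h2.clm_apply h4)).sub (continuous_const.mul h3)
  have hRemc : ∀ n : ℕ, ∀ s : ℝ, s < 0 → Continuous fun x => Rem n s x := by
    intro n s hs
    rw [hRem]
    have h1 : Continuous (φ s) := (hφs s hs).continuous
    have h2 : Continuous (fderiv ℝ (φ s)) := (hφ1 s hs).continuous_fderiv one_ne_zero
    have h3 : Continuous (fderiv ℝ (cutoff (E := EuclideanSpace ℝ (Fin 3)) ((n : ℝ) + 1))) :=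
      (hχ1 _).continuous_fderiv one_ne_zero
    have h4 : Continuous (Δ (cutoff (E := EuclideanSpace ℝ (Fin 3)) ((n : ℝ) + 1))) :=
      continuous_laplacian (hχ2 _)
    have h5 := hvc s hs
    refine (h1.mul (h3.clm_apply h5)).sub (continuous_const.mul ((h1.mul h4).add
      (continuous_const.mul (continuous_finsetSum _ fun i _ => ?_))))
    exact (h2.clm_apply continuous_const).mul (h3.clm_apply continuous_const)
  -- pointwise bounds on the window
  have hAbd : ∀ s ∈ Icc a b, ∀ x, |A s x| ≤ B + B * V + |ν| * B := by
    intro s hs x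
    obtain ⟨-, h2, h3, h4⟩ := hB s hs x
    rw [hA]
    exact kernelPairing_abs_integrand_le h4 h2 (hvV s hs x) h3 hB0
  have hRembd : ∀ n : ℕ, ∀ s ∈ Icc a b, ∀ x,
      |Rem n s x| ≤ (B * C₁ * V + |ν| * (B * C₂ + 2 * (B * C₁))) / ((n : ℝ) + 1) := by
    intro n s hs x
    obtain ⟨h1, h2, -, -⟩ := hB s hs x
    have hR0 : (0 : ℝ) < (n : ℝ) + 1 := by positivity
    have hR1 : (1 : ℝ) ≤ (n : ℝ) + 1 := by simp
    rw [hRem]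
    exact kernelPairing_abs_remainder_le h1 (hC₁ _ hR0 x) (hvV s hs x) (hC₂ _ hR0 x)
      (abs_sum_fderiv_mul_fderiv_le bs (φ s) (cutoff ((n : ℝ) + 1)) x) h2 hB0 hC₁0 hC₂0 hR1
  have hMA0 : 0 ≤ B + B * V + |ν| * B := by positivity
  have hMR0 : 0 ≤ B * C₁ * V + |ν| * (B * C₂ + 2 * (B * C₁)) := by positivity
  -- integrability of the pairings on the window
  have hAK : ∀ s ∈ Icc a b, Integrable fun x => A s x * K s x := fun s hs =>
    (hK.integrable (hIcc hs)).bdd_mul (hAc s (hIcc hs)).aestronglyMeasurable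
      (ae_of_all _ fun x => by rw [Real.norm_eq_abs]; exact hAbd s hs x)
  have hGK : ∀ n : ℕ, ∀ s ∈ Icc a b,
      Integrable fun x => (cutoff ((n : ℝ) + 1) x * A s x + Rem n s x) * K s x := by
    intro n s hs
    refine (hK.integrable (hIcc hs)).bdd_mul
      (c := 1 * (B + B * V + |ν| * B)
        + (B * C₁ * V + |ν| * (B * C₂ + 2 * (B * C₁))) / ((n : ℝ) + 1))
      ((((hχc _).mul (hAc s (hIcc hs))).add (hRemc n s (hIcc hs))).aestronglyMeasurable)
      (ae_of_all _ fun x => ?_)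
    rw [Real.norm_eq_abs]
    calc |cutoff ((n : ℝ) + 1) x * A s x + Rem n s x|
        ≤ |cutoff ((n : ℝ) + 1) x * A s x| + |Rem n s x| := abs_add_le _ _
      _ ≤ 1 * (B + B * V + |ν| * B)
          + (B * C₁ * V + |ν| * (B * C₂ + 2 * (B * C₁))) / ((n : ℝ) + 1) := by
          rw [abs_mul]
          exact add_le_add (mul_le_mul (abs_cutoff_le_one _ _) (hAbd s hs x) (abs_nonneg _)
            zero_le_one) (hRembd n s hs x)
  /- 3. Derivatives of the cut-off pairings (the compactly supported identity, expanded). -/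
  have hder : ∀ n : ℕ, ∀ s ∈ Ioo a b,
      HasDerivAt (fun s => ∫ x, φ s x * cutoff ((n : ℝ) + 1) x * K s x) (gseq n s) s := by
    intro n s hs
    have hs0 : s ∈ Iio (0 : ℝ) := hIcc (hIoo hs)
    have hR : (0 : ℝ) < (n : ℝ) + 1 := by positivity
    have L := (kernelPairing_hasDerivAt_of_support_subset isOpen_Iio hv hdiv hK
      (kernelPairing_isSmoothSpaceTimeOn_mul_cutoff hφ ((n : ℝ) + 1))
      (isCompact_closedBall (0 : EuclideanSpace ℝ (Fin 3)) (2 * ((n : ℝ) + 1)))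
      (fun s _ x hx => kernelPairing_mul_cutoff_eq_zero hR s x hx) hs0).2
    rw [hgseq]
    refine L.congr_deriv (integral_congr_ae (Eventually.of_forall fun x => ?_))
    have hφd : DifferentiableAt ℝ (φ s) x := (hφ1 s hs0).differentiable one_ne_zero x
    have hχd : DifferentiableAt ℝ (cutoff (E := EuclideanSpace ℝ (Fin 3)) ((n : ℝ) + 1)) x :=
      (hχ1 _).differentiable one_ne_zero x
    show (deriv (fun r => φ r x * cutoff ((n : ℝ) + 1) x) s
        + fderiv ℝ (fun y => φ s y * cutoff ((n : ℝ) + 1) y) x (v s x)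
        - ν * (Δ fun y => φ s y * cutoff ((n : ℝ) + 1) y) x) * K s x
      = (cutoff ((n : ℝ) + 1) x * A s x + Rem n s x) * K s x
    rw [deriv_mul_const_field, fderiv_fun_mul hφd hχd,
      laplacian_mul_eq bs (hφ2 s hs0) (hχ2 _) x, hA, hRem]
    simp only [_root_.add_apply, _root_.FunLike.coe_smul, Pi.smul_apply, smul_eq_mul]
    ring
  /- 4. Pointwise convergence of the cut-off pairings (dominated convergence). -/
  have hptw : ∀ s ∈ Ioo a b, Tendsto (fun n : ℕ => ∫ x, φ s x * cutoff ((n : ℝ) + 1) x * K s x)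
      atTop (𝓝 (∫ x, φ s x * K s x)) := by
    intro s hs
    have hsI : s ∈ Icc a b := hIoo hs
    have hs0 : s < 0 := hIcc hsI
    refine tendsto_integral_of_dominated_convergence (fun x => B * K s x) (fun n => ?_)
      ((hK.integrable hs0).const_mul B) (fun n => Eventually.of_forall fun x => ?_)
      (Eventually.of_forall fun x => ?_)
    · exact ((((hφs s hs0).continuous).mul (hχc _)).mul (hKc s hs0)).aestronglyMeasurable
    · rw [norm_mul, norm_mul, Real.norm_eq_abs, Real.norm_eq_abs, Real.norm_eq_abs,
        abs_of_nonneg (hK0 s hs0 x)]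
      calc |φ s x| * |cutoff ((n : ℝ) + 1) x| * K s x ≤ B * 1 * K s x :=
            mul_le_mul_of_nonneg_right (mul_le_mul (hB s hsI x).1 (abs_cutoff_le_one _ _)
              (abs_nonneg _) hB0) (hK0 s hs0 x)
        _ = B * K s x := by ring
    · have := ((tendsto_cutoff_natCast_add_one x).const_mul (φ s x)).mul_const (K s x)
      simpa using this
  /- 5. Uniform convergence of the derivatives on the window. -/
  have hest : ∀ n : ℕ, ∀ s ∈ Icc a b, |gseq n s - G s| ≤ (B + B * V + |ν| * B) * e n
      + (B * C₁ * V + |ν| * (B * C₂ + 2 * (B * C₁))) / ((n : ℝ) + 1) := by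
    intro n s hs
    have hs0 : s < 0 := hIcc hs
    have i1 : Integrable fun x => (1 - cutoff ((n : ℝ) + 1) x) * g x :=
      hgi.bdd_mul (c := 1) ((continuous_const.sub (hχc _)).aestronglyMeasurable)
        (ae_of_all _ fun x => by
          rw [Real.norm_eq_abs, abs_le]
          constructor <;>
            linarith [cutoff_nonneg ((n : ℝ) + 1) x, cutoff_le_one ((n : ℝ) + 1) x])
    have i1' : Integrable fun x => (B + B * V + |ν| * B) * ((1 - cutoff ((n : ℝ) + 1) x) * g x) :=
      i1.const_mul _
    have i2 : Integrable fun x =>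
        (B * C₁ * V + |ν| * (B * C₂ + 2 * (B * C₁))) / ((n : ℝ) + 1) * K s x :=
      (hK.integrable hs0).const_mul _
    rw [hgseq, hGdef]
    simp only
    rw [← integral_sub (hGK n s hs) (hAK s hs), ← Real.norm_eq_abs]
    have i12 : Integrable fun x => (B + B * V + |ν| * B) * ((1 - cutoff ((n : ℝ) + 1) x) * g x)
        + (B * C₁ * V + |ν| * (B * C₂ + 2 * (B * C₁))) / ((n : ℝ) + 1) * K s x := i1'.add i2
    refine (norm_integral_le_of_norm_le i12 (Eventually.of_forall fun x => ?_)).trans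
      (le_of_eq ?_)
    · have h1χ : 0 ≤ 1 - cutoff ((n : ℝ) + 1) x := sub_nonneg.2 (cutoff_le_one _ _)
      rw [Real.norm_eq_abs, show (cutoff ((n : ℝ) + 1) x * A s x + Rem n s x) * K s x
          - A s x * K s x = ((cutoff ((n : ℝ) + 1) x - 1) * A s x + Rem n s x) * K s x by ring,
        abs_mul, abs_of_nonneg (hK0 s hs0 x)]
      have h1 : |(cutoff ((n : ℝ) + 1) x - 1) * A s x + Rem n s x|
          ≤ (1 - cutoff ((n : ℝ) + 1) x) * (B + B * V + |ν| * B)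
            + (B * C₁ * V + |ν| * (B * C₂ + 2 * (B * C₁))) / ((n : ℝ) + 1) := by
        calc |(cutoff ((n : ℝ) + 1) x - 1) * A s x + Rem n s x|
            ≤ |(cutoff ((n : ℝ) + 1) x - 1) * A s x| + |Rem n s x| := abs_add_le _ _
          _ = (1 - cutoff ((n : ℝ) + 1) x) * |A s x| + |Rem n s x| := by
              rw [abs_mul, abs_sub_comm, abs_of_nonneg h1χ]
          _ ≤ _ := add_le_add (mul_le_mul_of_nonneg_left (hAbd s hs x) h1χ) (hRembd n s hs x)
      calc |(cutoff ((n : ℝ) + 1) x - 1) * A s x + Rem n s x| * K s x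
          ≤ ((1 - cutoff ((n : ℝ) + 1) x) * (B + B * V + |ν| * B)
              + (B * C₁ * V + |ν| * (B * C₂ + 2 * (B * C₁))) / ((n : ℝ) + 1)) * K s x :=
            mul_le_mul_of_nonneg_right h1 (hK0 s hs0 x)
        _ = (B + B * V + |ν| * B) * ((1 - cutoff ((n : ℝ) + 1) x) * K s x)
              + (B * C₁ * V + |ν| * (B * C₂ + 2 * (B * C₁))) / ((n : ℝ) + 1) * K s x := by
            ring
        _ ≤ (B + B * V + |ν| * B) * ((1 - cutoff ((n : ℝ) + 1) x) * g x)
              + (B * C₁ * V + |ν| * (B * C₂ + 2 * (B * C₁))) / ((n : ℝ) + 1) * K s x :=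
            add_le_add (mul_le_mul_of_nonneg_left
              (mul_le_mul_of_nonneg_left (hKg s hs x) h1χ) hMA0) le_rfl
    · rw [integral_add i1' i2, integral_const_mul, integral_const_mul, hK.integral_eq_one s hs0,
        mul_one, he]
  have hδ : Tendsto (fun n : ℕ => (B + B * V + |ν| * B) * e n
      + (B * C₁ * V + |ν| * (B * C₂ + 2 * (B * C₁))) / ((n : ℝ) + 1)) atTop (𝓝 0) := by
    have h1 : Tendsto e atTop (𝓝 0) := by
      rw [he]; exact kernelPairing_tendsto_integral_one_sub_cutoff hgi
    have h2 := (tendsto_one_div_add_atTop_nhds_zero_nat (𝕜 := ℝ)).const_mul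
      (B * C₁ * V + |ν| * (B * C₂ + 2 * (B * C₁)))
    have h := (h1.const_mul (B + B * V + |ν| * B)).add h2
    simp only [mul_zero, add_zero] at h
    refine h.congr fun n => ?_
    simp only [mul_one_div]
  have hunif : TendstoUniformlyOn gseq G atTop (Ioo a b) := by
    refine Metric.tendstoUniformlyOn_iff.2 fun ε hε => ?_
    filter_upwards [hδ.eventually (gt_mem_nhds hε)] with n hn s hs
    rw [dist_comm, Real.dist_eq]
    exact (hest n s (hIoo hs)).trans_lt hn
  /- 6. Exchange of the limit and the derivative. -/
  have key := hasDerivAt_of_tendstoUniformlyOn isOpen_Ioo hunif (Eventually.of_forall hder)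
    hptw htI
  have hGt : G t = ∫ x, (deriv (fun s => φ s x) t + fderiv ℝ (φ t) x (v t x)
      - ν * (Δ (φ t)) x) * K t x := by
    rw [hGdef, hA]
  rw [hGt] at key
  exact key

end Summit.NavierStokesRegularity.NavierStokesRegularity.Theorems.FrequencyRigidity.TwoEndedPinning

end
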